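import Literature.NumberTheory.EllipticCurves.RootNumberTableThreeCondExpRowsProofs
import Literature.NumberTheory.EllipticCurves.RootNumberTableThreeLocalReadingsProofs
import Literature.NumberTheory.DiophantineGeometry.KodairaSymbol
import HarnessLib

/-!
# `f₃(E/ℚ)` = Table II's `v(N)`: the rows of types I₀, Iₙ, II, III, IV

`Proofs` file (theorems only; no definition, no named fact) in topic
`NumberTheory/EllipticCurves`, eighth file of the kernel discharge of
`WeierstrassCurve.conductorExponent_eq_tableConductorExponentThree` (cell `b2b-bsdres`, team n1011,
ROW T-PAP3).  For each Kodaira type of Steps 1–5 of Tate's algorithm, the corresponding disjunct of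
the local row datum `TateAlgorithm.rowDatum_of_minimal` (stated here for an arbitrary `M` over `ℤ₃`
with `c₄(M) = u⁴c₄(W)`, `c₆(M) = u⁶c₆(W)`, `Δ(M) = u¹²Δ(W)`) yields Ogg's value
`ord₃Δ(M) + 1 − m` = `Rizzo.condExpOfInvariants c₄ c₆ Δ`: the readings of
`RootNumberTableThreeLocalReadingsProofs` feed the row evaluations of
`RootNumberTableThreeCondExpRowsProofs`.  The companion file `RootNumberTableThreeCondExpProofs`
does the same for the starred types and assembles the discharge.

## References

* O. G. Rizzo, Compositio Math. 136 (2003) 1–23, Table II (p. 4). [Rizzo2003]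
* J. H. Silverman, *Advanced Topics in the Arithmetic of Elliptic Curves*, GTM 151 (1994), IV.9.4,
  Table 4.1, IV.11.1. [Silverman1994]
-/

noncomputable section

open IsDiscreteValuationRing IsDedekindDomain IsLocalRing
open Literature.NumberTheory.DiophantineGeometry Literature.NumberTheory.DiophantineGeometry.TateAlgorithm
open Literature.NumberTheory.EllipticCurves Literature.NumberTheory.EllipticCurves.Rizzo

namespace WeierstrassCurve

variable {W : WeierstrassCurve ℚ} {M : WeierstrassCurve ℤ_[3]} {u : ℚ_[3]}

/-- **Type I₀ — rows (0,0,0), (1,≥3,0).**  Along `M = C • W_{ℚ₃}` (`c₄(M) = u⁴c₄`, `c₆(M) = u⁶c₆`,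
`Δ(M) = u¹²Δ`), the row datum of `TateAlgorithm.rowDatum_of_minimal` for this type gives Ogg's
value `ord Δ + 1 − m` equal to Table II's `v(N)` read on the invariants of `W`.
[cite: Rizzo2003, Table II (p. 4), column v(N)] [cite: Silverman1994, IV.9.4 and Table 4.1] -/
theorem condExp_of_row_I0 (hu : u ≠ 0)
    (hc4 : (M.c₄ : ℚ_[3]) = u ^ 4 * (W.c₄ : ℚ_[3])) (hc6 : (M.c₆ : ℚ_[3]) = u ^ 6 * (W.c₆ : ℚ_[3]))
    (hΔ : (M.Δ : ℚ_[3]) = u ^ 12 * (W.Δ : ℚ_[3])) (hWΔ : W.Δ ≠ 0)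
    (hΔ3 : ¬ (3 : ℤ_[3]) ∣ M.Δ)
    (hsub : (¬ (3 : ℤ_[3]) ∣ M.c₄ ∧ ¬ (3 : ℤ_[3]) ∣ M.c₆) ∨
      ((addVal ℤ_[3] M.c₄).toNat = 1 ∧ (3 : ℤ_[3]) ^ 3 ∣ M.c₆)) :
    (addVal ℤ_[3] M.Δ).toNat + 1 - (KodairaSymbol.I 0).numComponents =
      condExpOfInvariants W.c₄ W.c₆ W.Δ := by
  have hΔv := addVal_toNat_eq_zero_of_not_dvd hΔ3
  have hΔ' := padicValRat_eq_of_addVal_eq hu hΔ hWΔ hΔv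
  rcases hsub with ⟨hc4nd, hc6nd⟩ | ⟨h4v, hc6d⟩
  · -- row (0,0,0)
    have h4 := val3_eq_of_not_three_dvd hu hc4 hc4nd
    have h6 := val3_eq_of_not_three_dvd hu hc6 hc6nd
    simp only [Nat.cast_zero, Nat.cast_ofNat, WithTop.coe_zero] at h4 h6 hΔ'
    rw [condExpOfInvariants_eq_of_shift_zero h4 h6 hΔ' (by decide), condExp_row_0_0_0, hΔv]
    decide
  · -- row (1,≥3,0)
    have h4 := val3_eq_of_addVal_eq hu hc4 h4v le_rfl
    obtain ⟨b, h6, hbge, -⟩ := exists_val3_of_pow_dvd hu hc6 hc6d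
    simp only [Nat.cast_zero, Nat.cast_one, Nat.cast_ofNat, WithTop.coe_one] at h4 h6 hΔ' hbge
    have hs : KellockDokchitser.shift 0 b 1 = 0 :=
      shift_eq_zero le_rfl (nonneg_of_forall_coe hbge) (by norm_num) (Or.inl (by norm_num))
    rw [condExpOfInvariants_eq_of_shift_zero h4 h6 hΔ' hs, condExp_row_1_ge3_0 (atLeast_of_forall_coe hbge)
      (by simpa using ne_coe_of_forall_coe hbge (show (0 : ℤ) < 3 by norm_num)), hΔv]
    decide

/-- **Type Iₙ — row (0,0,n).**  Along `M = C • W_{ℚ₃}` (`c₄(M) = u⁴c₄`, `c₆(M) = u⁶c₆`,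
`Δ(M) = u¹²Δ`), the row datum of `TateAlgorithm.rowDatum_of_minimal` for this type gives Ogg's
value `ord Δ + 1 − m` equal to Table II's `v(N)` read on the invariants of `W`.
[cite: Rizzo2003, Table II (p. 4), column v(N)] [cite: Silverman1994, IV.9.4 and Table 4.1] -/
theorem condExp_of_row_In (hu : u ≠ 0)
    (hc4 : (M.c₄ : ℚ_[3]) = u ^ 4 * (W.c₄ : ℚ_[3])) (hc6 : (M.c₆ : ℚ_[3]) = u ^ 6 * (W.c₆ : ℚ_[3]))
    (hΔ : (M.Δ : ℚ_[3]) = u ^ 12 * (W.Δ : ℚ_[3])) (hWΔ : W.Δ ≠ 0)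
    {n : ℕ} (hn1 : 1 ≤ n) (hΔn : (addVal ℤ_[3] M.Δ).toNat = n)
    (hc4nd : ¬ (3 : ℤ_[3]) ∣ M.c₄) (hc6nd : ¬ (3 : ℤ_[3]) ∣ M.c₆) :
    (addVal ℤ_[3] M.Δ).toNat + 1 - (KodairaSymbol.I n).numComponents =
      condExpOfInvariants W.c₄ W.c₆ W.Δ := by
  have hΔ' := padicValRat_eq_of_addVal_eq hu hΔ hWΔ hΔn
  have h4 := val3_eq_of_not_three_dvd hu hc4 hc4nd
  have h6 := val3_eq_of_not_three_dvd hu hc6 hc6nd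
  simp only [Nat.cast_ofNat, WithTop.coe_zero] at h4 h6 hΔ'
  have hs : KellockDokchitser.shift (n : ℤ) 0 0 = 0 :=
    shift_eq_zero (by positivity) le_rfl le_rfl (Or.inr (Or.inl ⟨0, by norm_cast, by norm_num⟩))
  rw [condExpOfInvariants_eq_of_shift_zero h4 h6 hΔ' hs, condExp_row_0_0_pos (by exact_mod_cast hn1), hΔn,
    KodairaSymbol.numComponents_I_of_ne_zero (by omega)]
  omega

/-- **Type II — rows (≥2,3,3), (2,4,3), (2,3,4), (≥3,4,5).**  Along `M = C • W_{ℚ₃}` (`c₄(M) = u⁴c₄`, `c₆(M) = u⁶c₆`,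
`Δ(M) = u¹²Δ`), the row datum of `TateAlgorithm.rowDatum_of_minimal` for this type gives Ogg's
value `ord Δ + 1 − m` equal to Table II's `v(N)` read on the invariants of `W`.
[cite: Rizzo2003, Table II (p. 4), column v(N)] [cite: Silverman1994, IV.9.4 and Table 4.1] -/
theorem condExp_of_row_II (hu : u ≠ 0)
    (hc4 : (M.c₄ : ℚ_[3]) = u ^ 4 * (W.c₄ : ℚ_[3])) (hc6 : (M.c₆ : ℚ_[3]) = u ^ 6 * (W.c₆ : ℚ_[3]))
    (hΔ : (M.Δ : ℚ_[3]) = u ^ 12 * (W.Δ : ℚ_[3])) (hWΔ : W.Δ ≠ 0)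
    (hsub : ((addVal ℤ_[3] M.Δ).toNat = 3 ∧ (3 : ℤ_[3]) ^ 2 ∣ M.c₄ ∧ (addVal ℤ_[3] M.c₆).toNat = 3 ∧
          ∃ β B₄ B₆ : ℤ_[3], M.c₄ = 9 * (β ^ 2 - 8 * B₄) ∧
            M.c₆ = 27 * (-β ^ 3 + 12 * β * B₄ - 24 * B₆) ∧ IsUnit β ∧ IsUnit B₄ ∧ IsUnit B₆) ∨
        ((addVal ℤ_[3] M.Δ).toNat = 3 ∧ (addVal ℤ_[3] M.c₄).toNat = 2 ∧ (addVal ℤ_[3] M.c₆).toNat = 4) ∨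
        ((addVal ℤ_[3] M.Δ).toNat = 4 ∧ (addVal ℤ_[3] M.c₄).toNat = 2 ∧ (addVal ℤ_[3] M.c₆).toNat = 3) ∨
        ((addVal ℤ_[3] M.Δ).toNat = 5 ∧ (3 : ℤ_[3]) ^ 3 ∣ M.c₄ ∧ (addVal ℤ_[3] M.c₆).toNat = 4)) :
    (addVal ℤ_[3] M.Δ).toNat + 1 - KodairaSymbol.II.numComponents =
      condExpOfInvariants W.c₄ W.c₆ W.Δ := by
  have h3 : Irreducible (3 : ℤ_[3]) := irreducible_three_padicInt
  rcases hsub with ⟨hΔv, hc4d, h6v, β, B₄, B₆, hC4, hC6, hβ, -, hB₆⟩ | ⟨hΔv, h4v, h6v⟩ |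
      ⟨hΔv, h4v, h6v⟩ | ⟨hΔv, hc4d, h6v⟩
  · -- row (≥2,3,3), special condition FALSE
    obtain ⟨a, h4, hage, hcase⟩ := exists_val3_of_pow_dvd hu hc4 hc4d
    have h6 := val3_eq_of_addVal_eq hu hc6 h6v (by norm_num)
    have hΔ' := padicValRat_eq_of_addVal_eq hu hΔ hWΔ hΔv
    simp only [Nat.cast_ofNat, WithTop.coe_ofNat] at h4 h6 hΔ' hage
    have hs : KellockDokchitser.shift 3 3 a = 0 :=
      shift_eq_zero (by norm_num) (by norm_num) (nonneg_of_forall_coe hage) (Or.inl (by norm_num))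
    have hC4' : M.c₄ = 3 ^ 2 * (β ^ 2 - 8 * B₄) := by rw [hC4]; norm_num
    have hC6' : M.c₆ = 3 ^ 3 * (-β ^ 3 + 12 * β * B₄ - 24 * B₆) := by rw [hC6]; norm_num
    have hiff := three_dvd_iff_sp hu hc4 hc6 2 3 β B₄ B₆ hβ hC4' hC6' h6v (by norm_num) a hcase
    have hsp : decide ((res9 W.c₆ ^ 2 + 2) % 9 = 3 * c4e a (res9 W.c₄) 2 % 9) = false :=
      decide_eq_false fun h => (isUnit_iff_not_dvd h3 _).mp hB₆ (hiff.mpr h)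
    rw [condExpOfInvariants_eq_of_shift_zero h4 h6 hΔ' hs, condExp_row_ge2_3_3_of_not_sp (atLeast_of_forall_coe hage) _ _ _ hsp,
      hΔv]
    decide
  · -- row (2,4,3)
    have h4 := val3_eq_of_addVal_eq hu hc4 h4v (by norm_num)
    have h6 := val3_eq_of_addVal_eq hu hc6 h6v (by norm_num)
    have hΔ' := padicValRat_eq_of_addVal_eq hu hΔ hWΔ hΔv
    simp only [Nat.cast_ofNat, WithTop.coe_ofNat] at h4 h6 hΔ'
    rw [condExpOfInvariants_eq_of_shift_zero h4 h6 hΔ' (by decide), condExp_row_2_4_3, hΔv]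
    decide
  · -- row (2,3,4)
    have h4 := val3_eq_of_addVal_eq hu hc4 h4v (by norm_num)
    have h6 := val3_eq_of_addVal_eq hu hc6 h6v (by norm_num)
    have hΔ' := padicValRat_eq_of_addVal_eq hu hΔ hWΔ hΔv
    simp only [Nat.cast_ofNat, WithTop.coe_ofNat] at h4 h6 hΔ'
    rw [condExpOfInvariants_eq_of_shift_zero h4 h6 hΔ' (by decide), condExp_row_2_3_4, hΔv]
    decide
  · -- row (≥3,4,5)
    obtain ⟨a, h4, hage, -⟩ := exists_val3_of_pow_dvd hu hc4 hc4d
    have h6 := val3_eq_of_addVal_eq hu hc6 h6v (by norm_num)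
    have hΔ' := padicValRat_eq_of_addVal_eq hu hΔ hWΔ hΔv
    simp only [Nat.cast_ofNat, WithTop.coe_ofNat] at h4 h6 hΔ' hage
    have hs : KellockDokchitser.shift 5 4 a = 0 :=
      shift_eq_zero (by norm_num) (by norm_num) (nonneg_of_forall_coe hage) (Or.inl (by norm_num))
    rw [condExpOfInvariants_eq_of_shift_zero h4 h6 hΔ' hs, condExp_row_ge3_4_5 (atLeast_of_forall_coe hage)
      (by simpa using ne_coe_of_forall_coe hage (show (2 : ℤ) < 3 by norm_num)), hΔv]
    decide

/-- **Type III — rows (≥2,3,3), (2,≥5,3).**  Along `M = C • W_{ℚ₃}` (`c₄(M) = u⁴c₄`, `c₆(M) = u⁶c₆`,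
`Δ(M) = u¹²Δ`), the row datum of `TateAlgorithm.rowDatum_of_minimal` for this type gives Ogg's
value `ord Δ + 1 − m` equal to Table II's `v(N)` read on the invariants of `W`.
[cite: Rizzo2003, Table II (p. 4), column v(N)] [cite: Silverman1994, IV.9.4 and Table 4.1] -/
theorem condExp_of_row_III (hu : u ≠ 0)
    (hc4 : (M.c₄ : ℚ_[3]) = u ^ 4 * (W.c₄ : ℚ_[3])) (hc6 : (M.c₆ : ℚ_[3]) = u ^ 6 * (W.c₆ : ℚ_[3]))
    (hΔ : (M.Δ : ℚ_[3]) = u ^ 12 * (W.Δ : ℚ_[3])) (hWΔ : W.Δ ≠ 0)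
    (hΔv : (addVal ℤ_[3] M.Δ).toNat = 3)
    (hsub : ((3 : ℤ_[3]) ^ 2 ∣ M.c₄ ∧ (addVal ℤ_[3] M.c₆).toNat = 3 ∧
          ∃ β B₄ B₆ : ℤ_[3], M.c₄ = 9 * (β ^ 2 - 8 * B₄) ∧
            M.c₆ = 27 * (-β ^ 3 + 12 * β * B₄ - 24 * B₆) ∧ IsUnit β ∧ IsUnit B₄ ∧ (3 : ℤ_[3]) ∣ B₆) ∨
        ((addVal ℤ_[3] M.c₄).toNat = 2 ∧ (3 : ℤ_[3]) ^ 5 ∣ M.c₆)) :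
    (addVal ℤ_[3] M.Δ).toNat + 1 - KodairaSymbol.III.numComponents =
      condExpOfInvariants W.c₄ W.c₆ W.Δ := by
  have h3 : Irreducible (3 : ℤ_[3]) := irreducible_three_padicInt
  have hΔ' := padicValRat_eq_of_addVal_eq hu hΔ hWΔ hΔv
  simp only [Nat.cast_ofNat] at hΔ'
  rcases hsub with ⟨hc4d, h6v, β, B₄, B₆, hC4, hC6, hβ, -, hB₆⟩ | ⟨h4v, hc6d⟩
  · -- row (≥2,3,3), special condition TRUE
    obtain ⟨a, h4, hage, hcase⟩ := exists_val3_of_pow_dvd hu hc4 hc4d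
    have h6 := val3_eq_of_addVal_eq hu hc6 h6v (by norm_num)
    simp only [Nat.cast_ofNat, WithTop.coe_ofNat] at h4 h6 hage
    have hs : KellockDokchitser.shift 3 3 a = 0 :=
      shift_eq_zero (by norm_num) (by norm_num) (nonneg_of_forall_coe hage) (Or.inl (by norm_num))
    have hC4' : M.c₄ = 3 ^ 2 * (β ^ 2 - 8 * B₄) := by rw [hC4]; norm_num
    have hC6' : M.c₆ = 3 ^ 3 * (-β ^ 3 + 12 * β * B₄ - 24 * B₆) := by rw [hC6]; norm_num
    have hiff := three_dvd_iff_sp hu hc4 hc6 2 3 β B₄ B₆ hβ hC4' hC6' h6v (by norm_num) a hcase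
    have hsp : decide ((res9 W.c₆ ^ 2 + 2) % 9 = 3 * c4e a (res9 W.c₄) 2 % 9) = true :=
      decide_eq_true (hiff.mp hB₆)
    rw [condExpOfInvariants_eq_of_shift_zero h4 h6 hΔ' hs, condExp_row_ge2_3_3_of_sp (atLeast_of_forall_coe hage) _ _ _ hsp,
      hΔv]
    decide
  · -- row (2,≥5,3)
    have h4 := val3_eq_of_addVal_eq hu hc4 h4v (by norm_num)
    obtain ⟨b, h6, hbge, -⟩ := exists_val3_of_pow_dvd hu hc6 hc6d
    simp only [Nat.cast_ofNat, WithTop.coe_ofNat] at h4 h6 hbge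
    have hs : KellockDokchitser.shift 3 b 2 = 0 :=
      shift_eq_zero (by norm_num) (nonneg_of_forall_coe hbge) (by norm_num) (Or.inl (by norm_num))
    rw [condExpOfInvariants_eq_of_shift_zero h4 h6 hΔ' hs, condExp_row_2_ge5_3 (atLeast_of_forall_coe hbge)
      (by simpa using ne_coe_of_forall_coe hbge (show (3 : ℤ) < 5 by norm_num))
      (by simpa using ne_coe_of_forall_coe hbge (show (4 : ℤ) < 5 by norm_num))
      (by simpa using ne_coe_of_forall_coe hbge (show (2 : ℤ) < 5 by norm_num)), hΔv]
    decide

/-- **Type IV — rows (2,3,5), (3,5,6), (≥4,5,7).**  Along `M = C • W_{ℚ₃}` (`c₄(M) = u⁴c₄`, `c₆(M) = u⁶c₆`,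
`Δ(M) = u¹²Δ`), the row datum of `TateAlgorithm.rowDatum_of_minimal` for this type gives Ogg's
value `ord Δ + 1 − m` equal to Table II's `v(N)` read on the invariants of `W`.
[cite: Rizzo2003, Table II (p. 4), column v(N)] [cite: Silverman1994, IV.9.4 and Table 4.1] -/
theorem condExp_of_row_IV (hu : u ≠ 0)
    (hc4 : (M.c₄ : ℚ_[3]) = u ^ 4 * (W.c₄ : ℚ_[3])) (hc6 : (M.c₆ : ℚ_[3]) = u ^ 6 * (W.c₆ : ℚ_[3]))
    (hΔ : (M.Δ : ℚ_[3]) = u ^ 12 * (W.Δ : ℚ_[3])) (hWΔ : W.Δ ≠ 0)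
    (hsub : ((addVal ℤ_[3] M.c₄).toNat = 2 ∧ (addVal ℤ_[3] M.c₆).toNat = 3 ∧ (addVal ℤ_[3] M.Δ).toNat = 5) ∨
        ((addVal ℤ_[3] M.c₄).toNat = 3 ∧ (addVal ℤ_[3] M.c₆).toNat = 5 ∧ (addVal ℤ_[3] M.Δ).toNat = 6) ∨
        ((3 : ℤ_[3]) ^ 4 ∣ M.c₄ ∧ (addVal ℤ_[3] M.c₆).toNat = 5 ∧ (addVal ℤ_[3] M.Δ).toNat = 7)) :
    (addVal ℤ_[3] M.Δ).toNat + 1 - KodairaSymbol.IV.numComponents =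
      condExpOfInvariants W.c₄ W.c₆ W.Δ := by
  rcases hsub with ⟨h4v, h6v, hΔv⟩ | ⟨h4v, h6v, hΔv⟩ | ⟨hc4d, h6v, hΔv⟩
  · -- row (2,3,5)
    have h4 := val3_eq_of_addVal_eq hu hc4 h4v (by norm_num)
    have h6 := val3_eq_of_addVal_eq hu hc6 h6v (by norm_num)
    have hΔ' := padicValRat_eq_of_addVal_eq hu hΔ hWΔ hΔv
    simp only [Nat.cast_ofNat, WithTop.coe_ofNat] at h4 h6 hΔ'
    rw [condExpOfInvariants_eq_of_shift_zero h4 h6 hΔ' (by decide), condExp_row_2_3_5, hΔv]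
    decide
  · -- row (3,5,6)
    have h4 := val3_eq_of_addVal_eq hu hc4 h4v (by norm_num)
    have h6 := val3_eq_of_addVal_eq hu hc6 h6v (by norm_num)
    have hΔ' := padicValRat_eq_of_addVal_eq hu hΔ hWΔ hΔv
    simp only [Nat.cast_ofNat, WithTop.coe_ofNat] at h4 h6 hΔ'
    rw [condExpOfInvariants_eq_of_shift_zero h4 h6 hΔ' (by decide), condExp_row_3_5_6, hΔv]
    decide
  · -- row (≥4,5,7)
    obtain ⟨a, h4, hage, -⟩ := exists_val3_of_pow_dvd hu hc4 hc4d
    have h6 := val3_eq_of_addVal_eq hu hc6 h6v (by norm_num)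
    have hΔ' := padicValRat_eq_of_addVal_eq hu hΔ hWΔ hΔv
    simp only [Nat.cast_ofNat, WithTop.coe_ofNat] at h4 h6 hΔ' hage
    have hs : KellockDokchitser.shift 7 5 a = 0 :=
      shift_eq_zero (by norm_num) (by norm_num) (nonneg_of_forall_coe hage) (Or.inl (by norm_num))
    rw [condExpOfInvariants_eq_of_shift_zero h4 h6 hΔ' hs, condExp_row_ge4_5_7 (atLeast_of_forall_coe hage), hΔv]
    decide

/-- **Type II* — rows (4,6,11), (5,8,12)★, (≥6,8,13)★.**  Along `M = C • W_{ℚ₃}` (`c₄(M) = u⁴c₄`, `c₆(M) = u⁶c₆`,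
`Δ(M) = u¹²Δ`), the row datum of `TateAlgorithm.rowDatum_of_minimal` for this type gives Ogg's
value `ord Δ + 1 − m` equal to Table II's `v(N)` read on the invariants of `W`.
[cite: Rizzo2003, Table II (p. 4), column v(N)] [cite: Silverman1994, IV.9.4 and Table 4.1] -/
theorem condExp_of_row_IIstar (hu : u ≠ 0)
    (hc4 : (M.c₄ : ℚ_[3]) = u ^ 4 * (W.c₄ : ℚ_[3])) (hc6 : (M.c₆ : ℚ_[3]) = u ^ 6 * (W.c₆ : ℚ_[3]))
    (hΔ : (M.Δ : ℚ_[3]) = u ^ 12 * (W.Δ : ℚ_[3])) (hWΔ : W.Δ ≠ 0)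
    (hsub : ((addVal ℤ_[3] M.c₄).toNat = 4 ∧ (addVal ℤ_[3] M.c₆).toNat = 6 ∧ (addVal ℤ_[3] M.Δ).toNat = 11) ∨
        ((addVal ℤ_[3] M.c₄).toNat = 5 ∧ (addVal ℤ_[3] M.c₆).toNat = 8 ∧ (addVal ℤ_[3] M.Δ).toNat = 12) ∨
        ((3 : ℤ_[3]) ^ 6 ∣ M.c₄ ∧ (addVal ℤ_[3] M.c₆).toNat = 8 ∧ (addVal ℤ_[3] M.Δ).toNat = 13)) :
    (addVal ℤ_[3] M.Δ).toNat + 1 - KodairaSymbol.IIstar.numComponents =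
      condExpOfInvariants W.c₄ W.c₆ W.Δ := by
  rcases hsub with ⟨h4v, h6v, hΔv⟩ | ⟨h4v, h6v, hΔv⟩ | ⟨hc4d, h6v, hΔv⟩
  · -- row (4,6,11)
    have h4 := val3_eq_of_addVal_eq hu hc4 h4v (by norm_num)
    have h6 := val3_eq_of_addVal_eq hu hc6 h6v (by norm_num)
    have hΔ' := padicValRat_eq_of_addVal_eq hu hΔ hWΔ hΔv
    simp only [Nat.cast_ofNat, WithTop.coe_ofNat] at h4 h6 hΔ'
    rw [condExpOfInvariants_eq_of_shift_zero h4 h6 hΔ' (by decide), condExp_row_4_6_11, hΔv]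
    decide
  · -- row (5,8,12) ★: one step of reduction, reduced triple (1,2,0)
    have h4 := val3_eq_of_addVal_eq hu hc4 h4v (by norm_num)
    have h6 := val3_eq_of_addVal_eq hu hc6 h6v (by norm_num)
    have hΔ' := padicValRat_eq_of_addVal_eq hu hΔ hWΔ hΔv
    simp only [Nat.cast_ofNat, WithTop.coe_ofNat] at h4 h6 hΔ'
    rw [condExpOfInvariants_eq_of_shift_one h4 h6 hΔ' shift_12_8_5, hΔv]
    have e : (tableII (WithTop.map (fun m : ℤ => m - 4) 5) (WithTop.map (fun m : ℤ => m - 6) 8)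
        (12 - 12) (res9 W.c₄) (res9 W.c₆) (res9 W.Δ)).2.1 =
        (tableII 1 2 0 (res9 W.c₄) (res9 W.c₆) (res9 W.Δ)).2.1 := by
      congr 1
    rw [e, condExp_row_1_2_0]
    decide
  · -- row (≥6,8,13) ★: one step of reduction, reduced triple (≥2,2,1)
    obtain ⟨a, h4, hage, -⟩ := exists_val3_of_pow_dvd hu hc4 hc4d
    have h6 := val3_eq_of_addVal_eq hu hc6 h6v (by norm_num)
    have hΔ' := padicValRat_eq_of_addVal_eq hu hΔ hWΔ hΔv
    simp only [Nat.cast_ofNat, WithTop.coe_ofNat] at h4 h6 hΔ' hage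
    have hs : KellockDokchitser.shift 13 8 a = 1 := shift_13_8 (coe_le_of_forall_coe hage)
    rw [condExpOfInvariants_eq_of_shift_one h4 h6 hΔ' hs, hΔv]
    have hage2 : ∀ m : ℤ, a.map (fun m : ℤ => m - 4) = m → (2 : ℤ) ≤ m := by
      intro m hm
      cases a with
      | top => exact absurd hm WithTop.top_ne_coe
      | coe n =>
        have hn := hage n rfl
        have h' : ((n - 4 : ℤ) : WithTop ℤ) = (m : WithTop ℤ) := by rw [← hm, WithTop.map_coe]
        have : n - 4 = m := WithTop.coe_injective h'
        omega
    have e : (tableII (WithTop.map (fun m : ℤ => m - 4) a) (WithTop.map (fun m : ℤ => m - 6) 8)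
        (13 - 12) (res9 W.c₄) (res9 W.c₆) (res9 W.Δ)).2.1 =
        (tableII (WithTop.map (fun m : ℤ => m - 4) a) 2 1 (res9 W.c₄) (res9 W.c₆) (res9 W.Δ)).2.1 := by
      congr 1
    rw [e, condExp_row_ge2_2_1 (atLeast_of_forall_coe hage2)
      (by simpa using ne_coe_of_forall_coe hage2 (show (0 : ℤ) < 2 by norm_num))
      (by simpa using ne_coe_of_forall_coe hage2 (show (1 : ℤ) < 2 by norm_num))]
    decide


end WeierstrassCurve

end
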